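import Summits.HubbardSuperconductivity.HubbardSuperconductivity.Theorems.DeformationLadderLowEnergyRigidityDefs
import Summits.HubbardSuperconductivity.HubbardSuperconductivity.Theorems.BalabanIRBirEveryGroundStateSchur
import Mathlib.Analysis.Matrix.PosDef

/-!
# Route `DeformationLadder`, crux `LowEnergyRigidity` (item `stmt-HubbardSuperconductivity-1892`):
# the inheritance cut `CondensationGapAt U δ → MesoRigidityAt U δ → LowEnergyRigidity`

`LowEnergyRigidity` (`S⁺`): for some `U > 0`, `δ ∈ (0,1/2)`, `κ > 0`, `a > 0` and all large even `L`,
EVERY unit vector `φ` of `K_L = szSector N_L 0` (`N_L = 2⌊(1-δ)L²/2⌋`) with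
`Re⟨φ, H_L φ⟩ ≤ minEnergyOn H_L K_L + κ` has `L⁻⁴ Re⟨φ, Δ_dᴴΔ_d φ⟩ ≥ a`
(`H_L = hubbardTorus 2 L 1 U`, `Δ_d = pairField dWaveFormFactor L`). It is conjecture-grade
(O(1)-scale phase rigidity of the `d`-wave superconducting order of the two-dimensional Hubbard
ground state; equivalent to the route's target `LadderThesis` and to TwistGap's `TgThesis`, both
equivalences landed in `DeformationLadderLadderThesisNormalForms`).

This support file (`--supports stmt-HubbardSuperconductivity-1892`) kernel-checks the CUT of the crux
proposed by crux-idea `condensation-gap-inheritance` (ideator 1, round 1), over the vocabulary of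
`DeformationLadderLowEnergyRigidityDefs` (`blockPair`, `mesoOp`, `CondensationGapAt`, `MesoRigidityAt`):

* `re_expect_ge_of_penaltyGap` — the **inheritance lemma** (general finite-dimensional form): if
  penalising an operator `M` at strength `τ > 0` raises the sector ground energy of `A` by `g`, then
  every unit sector vector of `A`-energy `≤ minEnergyOn A K + κ` has `Re⟨M⟩ ≥ (g − κ)/τ`
  (one application of the variational principle `minEnergyOn_le_re_rayleigh`);
* `sum_blockPair` — `Σ_x B_R(x) = R² · Δ_d` (each local pair is counted once per block containing it);
* `mesoOp_sub_smul_eq_sum` — the **variance identity**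
  `𝓜_R − (R⁴/L²)·Δ_dᴴΔ_d = Σ_x (B_R(x) − (R²/L²)Δ_d)ᴴ (B_R(x) − (R²/L²)Δ_d)`, an algebraic form of
  Fejér-kernel positivity that needs no Fourier analysis;
* `posSemidef_mesoOp_sub_smul`, `smul_re_expect_pairField_le_re_expect_mesoOp`,
  `lro_le_mesoDensity` — hence `𝓜_R ≥ (R⁴/L²)·Δ_dᴴΔ_d` as forms: the block (mesoscopic) pair-order
  density `Re⟨𝓜_R⟩/(L²R⁴)` dominates the LRO density `Re⟨Δ_dᴴΔ_d⟩/L⁴` in EVERY state, so the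
  quantity `Re⟨𝓜_R⟩/(L²R⁴) − Re⟨Δ_dᴴΔ_d⟩/L⁴` rated by `MesoRigidityAt` is non-negative ("pair weight at
  nonzero momenta inside the window");
* `lowEnergyRigidity_of_condensationGap_of_mesoRigidity` — the **composition**: for `0 < U`,
  `δ ∈ (0,1/2)`, `CondensationGapAt U δ → MesoRigidityAt U δ → LowEnergyRigidity`, with
  `σ = θ/2`, `R = max R₀ R₁`, `κ = γθ/8`, `a = θ/4` and `L` so large that `ε L² > κ`
  (a mesoscopically unpaired low-energy state would pay `ε L² > κ`, so every low-energy state has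
  block order `> θ`; mesoscopic rigidity then converts block order minus slack minus `κ/γ` into LRO).

Companion `DeformationLadderLowEnergyRigidityCutNormalForms`: (A) ⟺ an extensive penalty gap of the
sector ground energies of `H_L + (τ/R⁴)𝓜_R` (thermodynamic), (B) ⟺ an `O(1)` bound on the sector
ground energy of `H_L − γ·W_R` (not thermodynamic).

What this does NOT do: it proves neither hypothesis. (A) `CondensationGapAt` is a thermodynamic
(energy-density) statement containing the pairing physics; (B) `MesoRigidityAt` is the `O(1)` residual
(an energy-weighted infrared bound over the mesoscopic window). The crux is thereby reduced BY NAME to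
(A) ∧ (B) at one point `(U, δ)`; the card's universal form of (B) (all `U > 0`, `δ ∈ (0,1/2)`) implies
the pointwise form used here.

Sources: idea card `Cruxes/LowEnergyRigidity/Ideas/condensation-gap-inheritance.md` (2026-08-16);
Lieb–Seiringer–Yngvason (2005) Thm 6.2, §7 (energy components of approximate minimisers); Tasaki (2020)
§2.1 (variational principle); Scalapino, Phys. Rep. 250 (1995) §2. All folklore linear algebra.
-/

noncomputable section

namespace Summit.HubbardSuperconductivity.HubbardSuperconductivity.Theorems.LowEnergyRigidity

set_option linter.dupNamespace false -- summit = problem name (single-conjunct summit), D-0017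

open Matrix
open scoped ComplexOrder
open Literature.MathematicalPhysics.QuantumLattice Literature.Probability.LatticeModels
open Summit.HubbardSuperconductivity.HubbardSuperconductivity.Theses.DeformationLadder
open Summit.HubbardSuperconductivity.HubbardSuperconductivity.Theorems
  (minEnergyOn_le_re_rayleigh bddBelow_rayleighSet)

/-! ### The inheritance lemma (general finite-dimensional form) -/

section Inheritance

variable {n : Type*} [Fintype n]

/-- **Inheritance lemma.** Let `A, M` be matrices, `K` a sector, `τ > 0`. If the penalised sector
energy satisfies `minEnergyOn A K + g ≤ minEnergyOn (A + τ M) K` (a penalty gap `g`), then every unit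
vector `φ ∈ K` with `Re⟨φ, A φ⟩ ≤ minEnergyOn A K + κ` has `Re⟨φ, M φ⟩ ≥ (g − κ)/τ`: by the
variational principle for `A + τM` at `φ`,
`minEnergyOn A K + g ≤ Re⟨φ, Aφ⟩ + τ Re⟨φ, Mφ⟩ ≤ minEnergyOn A K + κ + τ Re⟨φ, Mφ⟩`.
No hermiticity or positivity is needed. (The variational inequality read backwards: order of the
ground state enforced by an energy gap is INHERITED by every low-energy state; Lieb–Seiringer–Yngvason
2005, Thm 6.2 / §7 for the same lever on energy components of approximate minimisers.) [folklore] -/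
theorem re_expect_ge_of_penaltyGap (A M : Matrix n n ℂ) (K : Submodule ℂ (n → ℂ)) {τ g κ : ℝ}
    (hτ : 0 < τ) (hgap : A.minEnergyOn K + g ≤ (A + (τ : ℂ) • M).minEnergyOn K)
    {φ : n → ℂ} (hφK : φ ∈ K) (hφ : star φ ⬝ᵥ φ = 1)
    (hE : (star φ ⬝ᵥ A *ᵥ φ).re ≤ A.minEnergyOn K + κ) :
    (g - κ) / τ ≤ (star φ ⬝ᵥ M *ᵥ φ).re := by
  have h1 := minEnergyOn_le_re_rayleigh (A + (τ : ℂ) • M) K hφK hφ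
  rw [add_mulVec, dotProduct_add, Complex.add_re, smul_mulVec, dotProduct_smul, smul_eq_mul,
    Complex.re_ofReal_mul] at h1
  rw [div_le_iff₀ hτ]
  nlinarith

end Inheritance

/-! ### Block pair operators: `Σ_x B_R(x) = R²Δ_d` and the variance identity -/

section Blocks

variable (L : ℕ) [NeZero L] (R : ℕ)

/-- Translating the base point runs over every torus site exactly once:
`Σ_x P_{x + v} = Σ_x P_x = Δ_d` for every offset `v`. [folklore] -/
theorem sum_localPair_add (v : TorusSite 2 L) :
    ∑ x : TorusSite 2 L, localPair dWaveFormFactor L (x + v) = pairField dWaveFormFactor L := by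
  unfold pairField
  exact Fintype.sum_equiv (Equiv.addRight v) _ _ fun x => rfl

/-- **Block sum.** `Σ_x B_R(x) = R² · Δ_d`: summing the block pair operators over all block positions
counts every local pair once for each of the `R²` offsets. [folklore] -/
theorem sum_blockPair :
    ∑ x : TorusSite 2 L, blockPair L R x = ((R : ℂ) ^ 2) • pairField dWaveFormFactor L := by
  unfold blockPair
  rw [Finset.sum_comm]
  simp_rw [sum_localPair_add]
  rw [Finset.sum_const, Finset.card_univ, Fintype.card_prod, Fintype.card_fin,
    ← Nat.cast_smul_eq_nsmul ℂ]
  push_cast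
  ring_nf

/-- **Variance identity** (algebraic Fejér positivity). With `c = R²/L²`,
`Σ_x (B_R(x) − c Δ_d)ᴴ (B_R(x) − c Δ_d) = 𝓜_R − (R⁴/L²) · Δ_dᴴΔ_d`:
expand, use `Σ_x B_R(x) = R²Δ_d` on the two cross terms and `Σ_x 1 = L²` on the constant term.
[folklore] -/
theorem mesoOp_sub_smul_eq_sum :
    mesoOp L R - (((R : ℝ) ^ 4 / (L : ℝ) ^ 2 : ℝ) : ℂ) •
        ((pairField dWaveFormFactor L)ᴴ * pairField dWaveFormFactor L) =
      ∑ x : TorusSite 2 L,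
        (blockPair L R x - (((R : ℝ) ^ 2 / (L : ℝ) ^ 2 : ℝ) : ℂ) • pairField dWaveFormFactor L)ᴴ *
          (blockPair L R x - (((R : ℝ) ^ 2 / (L : ℝ) ^ 2 : ℝ) : ℂ) • pairField dWaveFormFactor L) := by
  have hL : (L : ℂ) ≠ 0 := by exact_mod_cast NeZero.ne L
  set P := pairField dWaveFormFactor L with hP
  set μ : ℂ := (((R : ℝ) ^ 2 / (L : ℝ) ^ 2 : ℝ) : ℂ) with hμ
  have hstar : star μ = μ := by rw [hμ]; exact Complex.conj_ofReal _
  have hcross₁ : ∑ x : TorusSite 2 L, (blockPair L R x)ᴴ * P = ((R : ℂ) ^ 2) • (Pᴴ * P) := by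
    rw [← Finset.sum_mul, ← conjTranspose_sum, sum_blockPair, conjTranspose_smul, Matrix.smul_mul]
    congr 1
    simp
  have hcross₂ : ∑ x : TorusSite 2 L, Pᴴ * blockPair L R x = ((R : ℂ) ^ 2) • (Pᴴ * P) := by
    rw [← Finset.mul_sum, sum_blockPair, Matrix.mul_smul]
  have hconst : ∑ _x : TorusSite 2 L, Pᴴ * P = ((L : ℂ) ^ 2) • (Pᴴ * P) := by
    rw [Finset.sum_const, Finset.card_univ, ← Nat.cast_smul_eq_nsmul ℂ]
    congr 1
    rw [Fintype.card_fun, ZMod.card, Fintype.card_fin]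
    push_cast
    ring
  have expand : ∀ x : TorusSite 2 L,
      (blockPair L R x - μ • P)ᴴ * (blockPair L R x - μ • P) =
        (blockPair L R x)ᴴ * blockPair L R x - μ • ((blockPair L R x)ᴴ * P) -
          μ • (Pᴴ * blockPair L R x) + (μ * μ) • (Pᴴ * P) := by
    intro x
    rw [conjTranspose_sub, conjTranspose_smul, hstar, sub_mul, mul_sub, mul_sub, Matrix.smul_mul,
      Matrix.smul_mul, Matrix.mul_smul, Matrix.mul_smul, smul_smul]
    abel
  symm
  calc ∑ x : TorusSite 2 L, (blockPair L R x - μ • P)ᴴ * (blockPair L R x - μ • P)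
      = ∑ x : TorusSite 2 L, ((blockPair L R x)ᴴ * blockPair L R x - μ • ((blockPair L R x)ᴴ * P) -
          μ • (Pᴴ * blockPair L R x) + (μ * μ) • (Pᴴ * P)) :=
        Finset.sum_congr rfl fun x _ => expand x
    _ = mesoOp L R - μ • ∑ x : TorusSite 2 L, (blockPair L R x)ᴴ * P -
          μ • ∑ x : TorusSite 2 L, Pᴴ * blockPair L R x +
          (μ * μ) • ∑ _x : TorusSite 2 L, Pᴴ * P := by
        rw [Finset.sum_add_distrib, Finset.sum_sub_distrib, Finset.sum_sub_distrib, ← Finset.smul_sum,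
          ← Finset.smul_sum, ← Finset.smul_sum]
        rfl
    _ = mesoOp L R - (μ * (R : ℂ) ^ 2 + μ * (R : ℂ) ^ 2 - μ * μ * (L : ℂ) ^ 2) • (Pᴴ * P) := by
        rw [hcross₁, hcross₂, hconst, smul_smul, smul_smul]
        module
    _ = mesoOp L R - (((R : ℝ) ^ 4 / (L : ℝ) ^ 2 : ℝ) : ℂ) • (Pᴴ * P) := by
        congr 2
        rw [hμ]
        push_cast
        field_simp
        ring

/-- **Fejér domination** (operator form): `𝓜_R − (R⁴/L²)·Δ_dᴴΔ_d` is positive semidefinite, being a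
sum of matrices of the form `Xᴴ X`. [folklore] -/
theorem posSemidef_mesoOp_sub_smul :
    (mesoOp L R - (((R : ℝ) ^ 4 / (L : ℝ) ^ 2 : ℝ) : ℂ) •
        ((pairField dWaveFormFactor L)ᴴ * pairField dWaveFormFactor L)).PosSemidef := by
  rw [mesoOp_sub_smul_eq_sum]
  exact posSemidef_sum _ fun _ _ => posSemidef_conjTranspose_mul_self _

/-- `𝓜_R` itself is positive semidefinite (a sum of `B_R(x)ᴴ B_R(x)`). [folklore] -/
theorem posSemidef_mesoOp : (mesoOp L R).PosSemidef :=
  posSemidef_sum _ fun _ _ => posSemidef_conjTranspose_mul_self _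

/-- **Fejér domination** (expectation form): `(R⁴/L²) · Re⟨φ, Δ_dᴴΔ_d φ⟩ ≤ Re⟨φ, 𝓜_R φ⟩` for every
vector `φ`. [folklore] -/
theorem smul_re_expect_pairField_le_re_expect_mesoOp (φ : Fock (Orb (FermionTorus 2 L))) :
    (R : ℝ) ^ 4 / (L : ℝ) ^ 2 *
        (expect ((pairField dWaveFormFactor L)ᴴ * pairField dWaveFormFactor L) φ).re ≤
      (expect (mesoOp L R) φ).re := by
  have h := (posSemidef_mesoOp_sub_smul L R).re_dotProduct_nonneg φ
  rw [RCLike.re_to_complex, sub_mulVec, dotProduct_sub, Complex.sub_re, smul_mulVec,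
    dotProduct_smul, smul_eq_mul, Complex.re_ofReal_mul] at h
  unfold expect
  linarith

/-- **LRO density ≤ block pair-order density**: for `R ≥ 1`,
`Re⟨φ, Δ_dᴴΔ_d φ⟩ / L⁴ ≤ Re⟨φ, 𝓜_R φ⟩ / (L² R⁴)` in every state — the difference (pair weight at
nonzero momenta inside the mesoscopic window) rated by `MesoRigidityAt` is non-negative. [folklore] -/
theorem lro_le_mesoDensity (hR : 1 ≤ R) (φ : Fock (Orb (FermionTorus 2 L))) :
    (expect ((pairField dWaveFormFactor L)ᴴ * pairField dWaveFormFactor L) φ).re / (L : ℝ) ^ 4 ≤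
      (expect (mesoOp L R) φ).re / ((L : ℝ) ^ 2 * (R : ℝ) ^ 4) := by
  have hL : (0 : ℝ) < (L : ℝ) := by exact_mod_cast Nat.pos_of_ne_zero (NeZero.ne L)
  have hR' : (0 : ℝ) < (R : ℝ) := by exact_mod_cast hR
  have h := smul_re_expect_pairField_le_re_expect_mesoOp L R φ
  rw [div_le_div_iff₀ (by positivity) (by positivity)]
  have h2 : (0 : ℝ) < (L : ℝ) ^ 2 := by positivity
  rw [div_mul_eq_mul_div, div_le_iff₀ h2] at h
  calc (expect ((pairField dWaveFormFactor L)ᴴ * pairField dWaveFormFactor L) φ).re *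
        ((L : ℝ) ^ 2 * (R : ℝ) ^ 4)
      = (R : ℝ) ^ 4 * (expect ((pairField dWaveFormFactor L)ᴴ * pairField dWaveFormFactor L) φ).re *
          (L : ℝ) ^ 2 := by ring
    _ ≤ (expect (mesoOp L R) φ).re * (L : ℝ) ^ 2 * (L : ℝ) ^ 2 := mul_le_mul_of_nonneg_right h h2.le
    _ = (expect (mesoOp L R) φ).re * ((L : ℝ) ^ 4) := by ring

/-- Degenerate block size: `B_0(x) = 0` (empty block). [folklore] -/
@[simp] theorem blockPair_zero_right (x : TorusSite 2 L) : blockPair L 0 x = 0 := by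
  simp [blockPair]

/-- Degenerate block size: `𝓜_0 = 0`. [folklore] -/
@[simp] theorem mesoOp_zero_right : mesoOp L 0 = 0 := by
  simp [mesoOp]

/-- Bookkeeping between the penalty normalisation `(τ/R⁴)·𝓜_R` and the block pair-order density
`Re⟨𝓜_R⟩/(L²R⁴)`: `Re⟨φ, ((τ/R⁴)·𝓜_R) φ⟩ = τ · L² · (Re⟨φ, 𝓜_R φ⟩/(L²R⁴))` (both sides vanish
for `R = 0`). [folklore] -/
theorem re_expect_penalisedMeso (τ : ℝ) (φ : Fock (Orb (FermionTorus 2 L))) :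
    (star φ ⬝ᵥ ((((τ / (R : ℝ) ^ 4 : ℝ) : ℂ) • mesoOp L R) *ᵥ φ)).re =
      τ * (L : ℝ) ^ 2 * ((expect (mesoOp L R) φ).re / ((L : ℝ) ^ 2 * (R : ℝ) ^ 4)) := by
  rcases Nat.eq_zero_or_pos R with hR | hR
  · subst hR
    simp
  have hR' : (R : ℝ) ≠ 0 := by exact_mod_cast hR.ne'
  have hL : (L : ℝ) ≠ 0 := by exact_mod_cast NeZero.ne L
  rw [smul_mulVec, dotProduct_smul, smul_eq_mul, Complex.re_ofReal_mul]
  unfold expect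
  field_simp

end Blocks

/-! ### The composition: (A) ∧ (B) at one point `(U, δ)` ⇒ `LowEnergyRigidity` -/

/-- **The inheritance cut closes the crux by name.** For `0 < U` and `δ ∈ (0,1/2)`,
`CondensationGapAt U δ → MesoRigidityAt U δ → LowEnergyRigidity`, with constants `σ = θ/2`,
`R = max R₀ R₁`, `κ = γθ/8`, `a = θ/4`. Proof: take `L` even, `≥` both thresholds and with
`ε L² > κ` (`L ≥ ⌈κ/ε⌉₊ + 1` suffices since `L² ≥ L`). A unit sector vector `φ` of energy
`≤ E₀ + κ` cannot be mesoscopically unpaired — (A) would give `E₀ + εL² ≤ E₀ + κ` — so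
`Re⟨𝓜_R⟩_φ/(L²R⁴) > θ`; then (B) gives `γ(θ − LRO − θ/2) < γ(meso − LRO − σ) ≤ κ = γθ/8`, i.e.
`LRO > θ/2 − θ/8 ≥ θ/4`. [folklore] -/
theorem lowEnergyRigidity_of_condensationGap_of_mesoRigidity {U δ : ℝ} (hU : 0 < U)
    (hδ : δ ∈ Set.Ioo (0 : ℝ) (1 / 2)) (hA : CondensationGapAt U δ) (hB : MesoRigidityAt U δ) :
    LowEnergyRigidity := by
  obtain ⟨θ, hθ, R₀, hA⟩ := hA
  obtain ⟨R₁, hB⟩ := hB (θ / 2) (by positivity)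
  obtain ⟨ε, hε, LA, hA⟩ := hA (max R₀ R₁) (le_max_left _ _)
  obtain ⟨γ, hγ, LB, hB⟩ := hB (max R₀ R₁) (le_max_right _ _)
  set R := max R₀ R₁ with hR
  set κ : ℝ := γ * θ / 8 with hκ
  have hκpos : 0 < κ := by positivity
  refine ⟨U, hU, δ, hδ, κ, hκpos, θ / 4, by positivity, max (max LA LB) (⌈κ / ε⌉₊ + 1), ?_⟩
  intro L _ hL hLeven φ hφK hφ1 hE
  have hLA : LA ≤ L := le_trans (le_trans (le_max_left _ _) (le_max_left _ _)) hL
  have hLB : LB ≤ L := le_trans (le_trans (le_max_right _ _) (le_max_left _ _)) hL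
  have hLceil : ⌈κ / ε⌉₊ + 1 ≤ L := le_trans (le_max_right _ _) hL
  -- `ε L² > κ`
  have hLreal : κ / ε < (L : ℝ) := by
    have h1 : κ / ε ≤ (⌈κ / ε⌉₊ : ℝ) := Nat.le_ceil _
    have h2 : ((⌈κ / ε⌉₊ + 1 : ℕ) : ℝ) ≤ (L : ℝ) := by exact_mod_cast hLceil
    push_cast at h2
    linarith
  have hL1 : (1 : ℝ) ≤ (L : ℝ) := by
    have : 1 ≤ L := le_trans (Nat.le_add_left 1 _) hLceil
    exact_mod_cast this
  have hεL : κ < ε * (L : ℝ) ^ 2 := by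
    have h1 : κ < ε * (L : ℝ) := by rwa [div_lt_iff₀ hε, mul_comm] at hLreal
    have h2 : ε * (L : ℝ) ≤ ε * (L : ℝ) ^ 2 := by
      rw [pow_two]
      exact mul_le_mul_of_nonneg_left (le_mul_of_one_le_right (by linarith) hL1) hε.le
    linarith
  -- abbreviations
  set E₀ := (hubbardTorus 2 L 1 U).minEnergyOn
    (szSector (Λ := FermionTorus 2 L) (2 * ⌊(1 - δ) * (L : ℝ) ^ 2 / 2⌋₊) 0) with hE₀
  set meso := (expect (mesoOp L R) φ).re / ((L : ℝ) ^ 2 * (R : ℝ) ^ 4) with hmeso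
  set lro := (expect ((pairField dWaveFormFactor L)ᴴ * pairField dWaveFormFactor L) φ).re /
    (L : ℝ) ^ 4 with hlro
  -- Step 1: `φ` is not mesoscopically unpaired
  have hmeso_gt : θ < meso := by
    by_contra hle
    rw [not_lt] at hle
    have h := hA L hLA hLeven φ hφK hφ1 hle
    -- `E₀ + ε L² ≤ ⟨H⟩ ≤ E₀ + κ`
    linarith
  -- Step 2: mesoscopic rigidity converts block order into LRO
  have h2 := hB L hLB hLeven φ hφK hφ1
  have h3 : γ * (meso - lro - θ / 2) ≤ κ := le_trans h2 (by linarith)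
  have h4 : meso - lro - θ / 2 ≤ θ / 8 := by
    have : γ * (meso - lro - θ / 2) ≤ γ * (θ / 8) := by rw [hκ] at h3; linarith
    exact le_of_mul_le_mul_left this hγ
  show θ / 4 ≤ lro
  linarith

end Summit.HubbardSuperconductivity.HubbardSuperconductivity.Theorems.LowEnergyRigidity
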